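import Mathlib

/-!
# PatchedWindingSpine — kernel anchors for the algebraic spine of PROPOSITION P⁺ (bsd-idea-6 g38 audit, §3)

Crux: `PrintX11a.UpperNonSurjFive` (stmt-BirchSwinnertonDyer-20614), line «monogen5» §4b ∕ §5 (P⁺ = patched winding element ⟹
`CleanCarrierSum`).  This file proves, sorry-free and over an arbitrary commutative ring, the two pieces of commutative algebra that the
audit memo `AUDIT-Pplus-print-g38.md` §3 uses verbatim:

* `ideal_eq_bot_of_le_minimalPrimes` — **P⁺4 (c)**: in a REDUCED ring an ideal contained in every minimal prime is `⊥`.  Applied to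
  `J = Ann_{R_∞}(M_∞)` with `M_∞ = R_∞ ∕ J` cyclic (multiplicity one at every Taylor–Wiles level) and `Supp M_∞ = Spec R_∞` (every
  component inhabited), it gives `M_∞ ≅ R_∞`.
* `ker_toSpanSingleton_unit_eq` ∕ `mk_mul_unit_eq_zero_iff` — **P⁺5 (kernel step)**: the kernel of `r ↦ r • u` onto a cyclic quotient
  `R ⧸ 𝔫` generated by a unit `u` is exactly `𝔫` (the old-quotient kernel is `𝔫ᵢ M_∞` once `M_∞ ≅ R_∞`).

Nothing here is specific to Hecke algebras; BSD is not proved by any of this; U5 does not close.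
[cite: KisinModuli2009, (3.3.1)] [cite: DiamondFLT1997, Thm. 2.4]
-/

set_option linter.dupNamespace false

namespace Summit.BirchSwinnertonDyer.BirchSwinnertonDyer.Cruxes.UpperNonSurjFive.Spine

/-- **P⁺4 (c).** In a reduced commutative ring, an ideal lying in every minimal prime is zero
(`⋂ minimal primes = nilradical = 0`). -/
theorem ideal_eq_bot_of_le_minimalPrimes {R : Type*} [CommRing R] [IsReduced R] (J : Ideal R)
    (h : ∀ q ∈ minimalPrimes R, J ≤ q) : J = ⊥ := by
  have h1 : J ≤ sInf (minimalPrimes R) := le_sInf h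
  have h2 : sInf (minimalPrimes R) = (⊥ : Ideal R).radical :=
    Ideal.sInf_minimalPrimes (I := (⊥ : Ideal R))
  have h3 : (⊥ : Ideal R).radical = ⊥ := by
    have h0 := nilradical_eq_zero R
    simpa [nilradical] using h0
  rw [h2, h3] at h1
  exact le_bot_iff.mp h1

/-- Cyclic + full support + reduced ⟹ free of rank one: if `M = R ⧸ J` has `J` inside every minimal prime of the reduced ring `R`,
then `J = ⊥`, i.e. the quotient map `R → R ⧸ J` is injective. -/
theorem quotient_mk_injective_of_le_minimalPrimes {R : Type*} [CommRing R] [IsReduced R] (J : Ideal R)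
    (h : ∀ q ∈ minimalPrimes R, J ≤ q) : Function.Injective (Ideal.Quotient.mk J) := by
  rw [RingHom.injective_iff_ker_eq_bot, Ideal.mk_ker]
  exact ideal_eq_bot_of_le_minimalPrimes J h

/-- **P⁺5 (kernel step), element form.** For a unit `u` of `R ⧸ N`: `(r mod N) · u = 0 ↔ r ∈ N`. -/
theorem mk_mul_unit_eq_zero_iff {R : Type*} [CommRing R] (N : Ideal R) {u : R ⧸ N} (hu : IsUnit u) (r : R) :
    Ideal.Quotient.mk N r * u = 0 ↔ r ∈ N := by
  rw [hu.mul_left_eq_zero, Ideal.Quotient.eq_zero_iff_mem]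

/-- **P⁺5 (kernel step), module form.** The kernel of the `R`-linear map `R → R ⧸ N`, `r ↦ r • u`, is `N` when `u` is a unit
(a generator of the cyclic module `R ⧸ N`). -/
theorem ker_toSpanSingleton_unit_eq {R : Type*} [CommRing R] (N : Ideal R) {u : R ⧸ N} (hu : IsUnit u) :
    LinearMap.ker (LinearMap.toSpanSingleton R (R ⧸ N) u) = N := by
  ext r
  rw [LinearMap.mem_ker, LinearMap.toSpanSingleton_apply, Algebra.smul_def, Ideal.Quotient.algebraMap_eq]
  exact mk_mul_unit_eq_zero_iff N hu r

end Summit.BirchSwinnertonDyer.BirchSwinnertonDyer.Cruxes.UpperNonSurjFive.Spine
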